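import Summits.QuantumFields.YangMills.Theorems.LuscherReductionTwistedTraceScalingBOStiffDoor
import HarnessLib

/-!
# R63 — THE FLAT POINCARÉ BRICK (P) OF THE (B-ST) DOOR IS A CENSORED INEQUALITY: jump form = censored form + killing, the exact
# killed transfer `Var_S ≤ P₀·(½ E_T + ∫_S g²κ_T)`, and a three-point witness that the killing slack can carry ALL of the variance
# (crux `LuscherReduction.TwistedTraceScaling`, stmt-QuantumFields-20203; a negative/tightness lemma on lane A's (B-ST) pen, door ✓p735077 `…BOStiffDoor`)

The DOOR `StiffDoor.form_le_of_quasimode_of_comparison` asks, besides the upper quasimode (Q), the weight comparison (ν) and the one-sided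
kernel comparison (J) `c_J·Λ·J₀ ≤ ΘMΘ`, for the FLAT POINCARÉ inequality (P)
`∫_S g²D − (∫_S gD)²/∫_S D ≤ P₀·½∫∫(g(x)−g(y))²J₀(x,y)` for the test function `g` (supported in `S`).  Because (J) is imposed on ALL of `X × X`
and `c_J, Λ > 0`, it forces `J₀ ≤ 0` wherever `Θ(x)Θ(y) = 0`: the flat jump kernel that can be fed to the door lives on `T × T`, `T := {Θ > 0}`
(the `r_f`-ball of the frozen profile `Ω_c` in the record instance), i.e. (P) is a CENSORED Poincaré inequality — jumps leaving `T` are not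
available — while the inequality one actually has for the flat pair (Mehler, ✓p735712 `…MehlerPoincare.mehler_poincare_normal`; tensorised in
✓p736179 `…BOStiffTensorPoincare`) is the GLOBAL one on `X`.

THIS FILE (model-free, in the door's own variables `{X} [MeasurableSpace X] {μ} [IsFiniteMeasure μ]`, bounded measurable data):

* ★★ `jumpForm_eq_censored_add_killing` — for `g = 0` off a measurable `T` and a symmetric bounded jump kernel `J`,
  `½∫_X∫_X (g(x)−g(y))²J = ½∫_T∫_T (g(x)−g(y))²J + ∫_T g(x)²·κ_T(x)`, `κ_T(x) := ∫_{Tᶜ} J(x,y) dy` (the Dirichlet form of the process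
  killed on leaving `T` = censored form + killing form) [folklore; Fukushima–Oshima–Takeda §4.4, Holley–Stroock];
* ★ `setVariance_le_variance` — `Var_S^D(g) ≤ Var_X^D(g)` for `g = 0` off `S`, `D ≥ 0`, `∫_S D > 0`;
* ★★ `killed_transfer` — a GLOBAL Poincaré inequality `Var_X^D(g) ≤ P₀·½∫∫(g(x)−g(y))²J` for `g` supported in `S ⊆ T` yields exactly
  `Var_S^D(g) ≤ P₀·(½∫_T∫_T (g(x)−g(y))²J + ∫_S g²κ_T)`, and ★ `censoredForm_eq` identifies `½∫_T∫_T(…)J` with the door's `½∫∫(…)J₀` for the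
  censored kernel `J₀ = J` on `T × T`, `0` off it; ★★ `killed_transfer_door` — under an EXIT-MASS bound `κ_T ≤ ε·D` on `S` this is the door's (P)
  PLUS the additive slack `P₀·ε·∫_S g²D` ("door v2 with killing slack", lane A DESIGN FINDING 3, `pub/ym-fleet/ym-luscher-20007-p1/HANDOFF-g21.md`):
  the slack is an `L²(D)`-mass term, NOT a jump-form term, so it cannot be absorbed into `P₀` — it has to be carried through the door and
  converted back with a REVERSE weight comparison `D ≤ C'_ν·Θ²w` on `S` (available only where `Θ` is bounded below, e.g. `S` = the `r_f/2`-ball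
  strictly inside `T` = the `r_f`-ball), landing in the output coefficient as `+ θ_door·C_ν C'_ν·P₀ε`;
* ★★ THREE-POINT WITNESS (`X = Fin 3`, counting measure, `D ≡ 1`, `J` = the path `0 — 1 — 2`, `S = T = {0, 2}`, `g = (1, 0, −1)`):
  `path_poincare` — the global inequality holds with the sharp constant `P₀ = 1` (gap of the path); `path_censored_fails` — the censored kernel
  on `S × S` vanishes identically, `Var_S^D(g) = 2 > P·0` for EVERY `P`: the censored inequality (P) is NOT inherited from the global one with any
  constant; `path_killed_eq` — `Var_S^D(g) = 2 = 1·(0 + 2)`: `killed_transfer` is an EQUALITY here, the killing slack carries the whole variance, so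
  the slack term can be neither dropped nor improved by a constant factor at this generality; packaged as ★★ `censored_poincare_not_inherited`; and ★★ `path_meanSlack_fails` — a slack on the MEAN term, `δ·(∫_S gD)²/∫_S D`, is not inherited
  either (the witness has flat mean zero): the inherited slack is the MASS term of `killed_transfer_door`.
* ★★ `killed_transfer_meanForm` — but for `P₀ε < 1` the mass slack IS convertible into a mean-type slack at the price of the renormalised constant `P₀/(1−P₀ε)`:
  `Var_S ≤ (P₀/(1−P₀ε))·½∫∫(δg)²J₀ + (P₀ε/(1−P₀ε))·(∫_S gD)²/∫_S D` (the witness sits at `P₀ε = 1`, where the conversion is void).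

HONEST FRAMING: a limitation-of-method / bookkeeping lemma about an abstract, correct door; NOT a refutation of `hST`, of (B-ST) or of the crux.
What it fixes for the record: (i) (P) is an independent brick — it does not follow from the Mehler/tensor Poincaré inequalities already landed, a
censored (Neumann-type) Poincaré inequality on `T` or the killed transfer above must be supplied; (ii) the exact shape and currency of the killing
slack the (B-ST) pen must consume (`ε` = flat jump mass from `supp g` to `{Θ = 0}`; for the record instance jumps of length `∼β^{-1/2}` from the
`r_f/2`-ball to outside the `r_f`-ball, `ε ∼ e^{−cβr_f²} = e^{−cℓ²}` when `r_f = β^{-1/2}ℓ` — one more slack that must stay below the `β`-free gain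
`θ_door`, cf. `…Negative.BOStiffDoorGainCeiling` (R62) for `η` and `δ`).  Stub of a child of the CONDITIONAL reduction route R2b1 (skeleton
«twolattice»); not infinite volume, not a mass gap, not Clay.
References: Fukushima–Oshima–Takeda, *Dirichlet forms and symmetric Markov processes* (2011) §4.4 (part process, killing measure);
Holley–Stroock, J. Stat. Phys. 46 (1987) 1159; Helffer, *Spectral theory and its applications* (2013) §7; Lüscher, Nucl. Phys. B219 (1983) 233, §3.
-/

set_option autoImplicit false

noncomputable section

open MeasureTheory

namespace Summit.QuantumFields.YangMills.Theorems.TwistedTraceScaling.Negative.R63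

open Summit.QuantumFields.YangMills.Theorems.FemtoTransferGap

/-! ## §1 Jump form = censored form + killing (model-free) -/

section General

variable {X : Type*} [MeasurableSpace X] {μ : Measure X} [IsFiniteMeasure μ]
variable {J J₀ : X → X → ℝ} {g D : X → ℝ} {CJ Cg CD : ℝ} {S T : Set X} {P₀ ε : ℝ}

/-- The jump integrand `(g(x) − g(y))²J(x,y)` is measurable and bounded by `(2C_g)²C_J`. [folklore] -/
theorem jumpIntegrand_bdd (hJ : Measurable (Function.uncurry J)) (hJb : ∀ x y, |J x y| ≤ CJ) (hg : Measurable g) (hgb : ∀ x, |g x| ≤ Cg) :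
    Measurable (Function.uncurry fun x y => (g x - g y) ^ 2 * J x y) ∧ ∀ x y, |(g x - g y) ^ 2 * J x y| ≤ (2 * Cg) ^ 2 * CJ := by
  refine ⟨(((hg.comp measurable_fst).sub (hg.comp measurable_snd)).pow_const 2).mul hJ, fun x y => ?_⟩
  rw [abs_mul, abs_pow]
  have h1 : |g x - g y| ≤ 2 * Cg := (abs_sub (g x) (g y)).trans (by linarith [hgb x, hgb y])
  exact mul_le_mul (pow_le_pow_left₀ (abs_nonneg _) h1 2) (hJb x y) (abs_nonneg _) (sq_nonneg _)

/-- The exit (killing) density `κ_T(x) = ∫_{Tᶜ} J(x,y) dy` is measurable and bounded. [folklore] -/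
theorem killingDensity_bdd (hJ : Measurable (Function.uncurry J)) (hJb : ∀ x y, |J x y| ≤ CJ) (T : Set X) :
    Measurable (fun x => ∫ y in Tᶜ, J x y ∂μ) ∧ ∀ x, |∫ y in Tᶜ, J x y ∂μ| ≤ CJ * (μ.restrict Tᶜ).real Set.univ :=
  StiffDoor.measurable_integral_right_of_bdd (μ := μ.restrict Tᶜ) hJ hJb

/-- ★★ **JUMP FORM = CENSORED FORM + KILLING.**  For a symmetric bounded measurable jump kernel `J` and a bounded measurable `g` vanishing off the
measurable set `T`: `½∫_X∫_X (g(x)−g(y))²J(x,y) = ½∫_T∫_T (g(x)−g(y))²J(x,y) + ∫_T g(x)²·(∫_{Tᶜ} J(x,y) dy) dx` — the Dirichlet form of the flat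
process splits into the part CENSORED to `T` and the KILLING on leaving `T`. [folklore] -/
theorem jumpForm_eq_censored_add_killing (hJ : Measurable (Function.uncurry J)) (hJb : ∀ x y, |J x y| ≤ CJ) (hsymm : ∀ x y, J x y = J y x)
    (hg : Measurable g) (hgb : ∀ x, |g x| ≤ Cg) (hgT : ∀ x, x ∉ T → g x = 0) (hT : MeasurableSet T) :
    (1 / 2) * ∫ x, ∫ y, (g x - g y) ^ 2 * J x y ∂μ ∂μ =
      (1 / 2) * (∫ x in T, ∫ y in T, (g x - g y) ^ 2 * J x y ∂μ ∂μ) + ∫ x in T, g x ^ 2 * (∫ y in Tᶜ, J x y ∂μ) ∂μ := by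
  obtain ⟨hFm, hFb⟩ := jumpIntegrand_bdd hJ hJb hg hgb
  obtain ⟨hκm, hκb⟩ := killingDensity_bdd (μ := μ) hJ hJb T
  -- every `y`-section is integrable for every finite measure
  have iF : ∀ (ν : Measure X) [IsFiniteMeasure ν] (x : X), Integrable (fun y => (g x - g y) ^ 2 * J x y) ν := fun ν _ x =>
    integrable_of_measurable_abs_le ν (hFm.comp measurable_prodMk_left) (C := (2 * Cg) ^ 2 * CJ) fun y => hFb x y
  -- (1) split the outer integral along `T`
  have iX : Integrable (fun x => ∫ y, (g x - g y) ^ 2 * J x y ∂μ) μ := by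
    obtain ⟨hm, hb⟩ := StiffDoor.measurable_integral_right_of_bdd (μ := μ) hFm hFb
    exact integrable_of_measurable_abs_le μ hm (C := (2 * Cg) ^ 2 * CJ * μ.real Set.univ) hb
  have h1 : ∫ x, ∫ y, (g x - g y) ^ 2 * J x y ∂μ ∂μ =
      (∫ x in T, ∫ y, (g x - g y) ^ 2 * J x y ∂μ ∂μ) + ∫ x in Tᶜ, ∫ y, (g x - g y) ^ 2 * J x y ∂μ ∂μ := (integral_add_compl hT iX).symm
  -- (2) for `x ∈ T`: split the inner integral along `T`; off `T` the integrand is `g(x)²J(x,y)`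
  have e2 : ∀ x, ∫ y, (g x - g y) ^ 2 * J x y ∂μ = (∫ y in T, (g x - g y) ^ 2 * J x y ∂μ) + g x ^ 2 * ∫ y in Tᶜ, J x y ∂μ := fun x => by
    rw [← integral_add_compl hT (iF μ x), ← integral_const_mul]
    congr 1
    exact setIntegral_congr_fun hT.compl fun y hy => by simp [hgT y hy]
  have iTT : Integrable (fun x => ∫ y in T, (g x - g y) ^ 2 * J x y ∂μ) (μ.restrict T) := by
    obtain ⟨hm, hb⟩ := StiffDoor.measurable_integral_right_of_bdd (μ := μ.restrict T) hFm hFb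
    exact integrable_of_measurable_abs_le (μ.restrict T) hm (C := (2 * Cg) ^ 2 * CJ * (μ.restrict T).real Set.univ) hb
  have iK : ∀ (A : Set X), Integrable (fun x => g x ^ 2 * ∫ y in Tᶜ, J x y ∂μ) (μ.restrict A) := fun A =>
    integrable_of_measurable_abs_le (μ.restrict A) ((hg.pow_const 2).mul hκm) (C := Cg ^ 2 * (CJ * (μ.restrict Tᶜ).real Set.univ)) fun x => by
      rw [abs_mul, abs_pow]
      exact mul_le_mul (pow_le_pow_left₀ (abs_nonneg _) (hgb x) 2) (hκb x) (abs_nonneg _) (sq_nonneg _)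
  have h2 : ∫ x in T, ∫ y, (g x - g y) ^ 2 * J x y ∂μ ∂μ =
      (∫ x in T, ∫ y in T, (g x - g y) ^ 2 * J x y ∂μ ∂μ) + ∫ x in T, g x ^ 2 * (∫ y in Tᶜ, J x y ∂μ) ∂μ := by
    rw [integral_congr_ae (ae_of_all _ e2), integral_add iTT (iK T)]
  -- (3) for `x ∉ T`: the integrand is `g(y)²J(y,x)` (symmetry), supported in `y ∈ T`; swap the two integrals
  have e3 : ∀ x, x ∈ Tᶜ → ∫ y, (g x - g y) ^ 2 * J x y ∂μ = ∫ y in T, g y ^ 2 * J y x ∂μ := fun x hx => by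
    have hx0 : g x = 0 := hgT x hx
    rw [← setIntegral_eq_integral_of_forall_compl_eq_zero (s := T) (fun y hy => by simp [hx0, hgT y hy])]
    exact setIntegral_congr_fun hT fun y _ => by simp [hx0, hsymm x y]
  have iG : Integrable (Function.uncurry fun x y => g y ^ 2 * J y x) ((μ.restrict Tᶜ).prod (μ.restrict T)) :=
    integrable_of_measurable_abs_le ((μ.restrict Tᶜ).prod (μ.restrict T))
      (((hg.comp measurable_snd).pow_const 2).mul (hJ.comp (measurable_snd.prodMk measurable_fst))) (C := Cg ^ 2 * CJ) fun p => by
      change |g p.2 ^ 2 * J p.2 p.1| ≤ Cg ^ 2 * CJ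
      rw [abs_mul, abs_pow]
      exact mul_le_mul (pow_le_pow_left₀ (abs_nonneg _) (hgb p.2) 2) (hJb p.2 p.1) (abs_nonneg _) (sq_nonneg _)
  have h3 : ∫ x in Tᶜ, ∫ y, (g x - g y) ^ 2 * J x y ∂μ ∂μ = ∫ x in T, g x ^ 2 * (∫ y in Tᶜ, J x y ∂μ) ∂μ := by
    rw [setIntegral_congr_fun hT.compl e3, integral_integral_swap iG]
    exact integral_congr_ae (ae_of_all _ fun y => integral_const_mul _ _)
  rw [h1, h2, h3]
  ring

omit [IsFiniteMeasure μ] in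
/-- ★ **The censored kernel in the door's notation.**  If `J₀ = J` on `T × T` and `J₀ = 0` off `T × T`, then
`∫∫ (g(x)−g(y))²J₀ = ∫_T∫_T (g(x)−g(y))²J`. [folklore] -/
theorem censoredForm_eq (hin : ∀ x ∈ T, ∀ y ∈ T, J₀ x y = J x y) (hout : ∀ x y, x ∉ T ∨ y ∉ T → J₀ x y = 0) (hT : MeasurableSet T) :
    ∫ x, ∫ y, (g x - g y) ^ 2 * J₀ x y ∂μ ∂μ = ∫ x in T, ∫ y in T, (g x - g y) ^ 2 * J x y ∂μ ∂μ := by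
  have inner : ∀ x ∈ T, ∫ y, (g x - g y) ^ 2 * J₀ x y ∂μ = ∫ y in T, (g x - g y) ^ 2 * J x y ∂μ := fun x hx => by
    rw [← setIntegral_eq_integral_of_forall_compl_eq_zero (s := T) fun y hy => by simp [hout x y (Or.inr hy)]]
    exact setIntegral_congr_fun hT fun y hy => by rw [hin x hx y hy]
  have outer : ∀ x, x ∉ T → ∫ y, (g x - g y) ^ 2 * J₀ x y ∂μ = 0 := fun x hx => by
    have h0 : ∀ y, J₀ x y = 0 := fun y => hout x y (Or.inl hx)
    simp [h0]
  rw [← setIntegral_eq_integral_of_forall_compl_eq_zero (s := T) outer]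
  exact setIntegral_congr_fun hT inner

/-! ## §2 The killed transfer: global Poincaré ⇒ the door's (P) plus the killing slack -/

/-- ★ **Restricting the variance to the support does not increase it:** for `g = 0` off `S`, `D ≥ 0` bounded measurable with `∫_S D > 0`,
`∫_S g²D − (∫_S gD)²/∫_S D ≤ ∫ g²D − (∫ gD)²/∫ D`. [folklore] -/
theorem setVariance_le_variance (hD : Measurable D) (hDb : ∀ x, |D x| ≤ CD) (hD0 : ∀ x, 0 ≤ D x) (hgS : ∀ x, x ∉ S → g x = 0)
    (hZS : 0 < ∫ x in S, D x ∂μ) :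
    (∫ x in S, g x ^ 2 * D x ∂μ) - (∫ x in S, g x * D x ∂μ) ^ 2 / (∫ x in S, D x ∂μ) ≤
      (∫ x, g x ^ 2 * D x ∂μ) - (∫ x, g x * D x ∂μ) ^ 2 / (∫ x, D x ∂μ) := by
  have e1 : ∫ x in S, g x ^ 2 * D x ∂μ = ∫ x, g x ^ 2 * D x ∂μ :=
    setIntegral_eq_integral_of_forall_compl_eq_zero fun x hx => by simp [hgS x hx]
  have e2 : ∫ x in S, g x * D x ∂μ = ∫ x, g x * D x ∂μ :=
    setIntegral_eq_integral_of_forall_compl_eq_zero fun x hx => by simp [hgS x hx]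
  have hZ : ∫ x in S, D x ∂μ ≤ ∫ x, D x ∂μ :=
    setIntegral_le_integral (integrable_of_measurable_abs_le μ hD (C := CD) hDb) (Filter.Eventually.of_forall hD0)
  rw [e1, e2]
  have h := div_le_div_of_nonneg_left (sq_nonneg (∫ x, g x * D x ∂μ)) hZS hZ
  linarith

/-- ★★ **THE KILLED TRANSFER.**  A GLOBAL flat Poincaré inequality `∫ g²D − (∫ gD)²/∫ D ≤ P₀·½∫∫(g(x)−g(y))²J` for a `g` supported in `S ⊆ T`
yields, on the support and with the jump kernel CENSORED to `T × T`, exactly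
`∫_S g²D − (∫_S gD)²/∫_S D ≤ P₀·(½∫_T∫_T (g(x)−g(y))²J + ∫_S g(x)²·(∫_{Tᶜ} J(x,y) dy) dx)` — the door's (P) for the censored kernel PLUS the killing
slack. [folklore] -/
theorem killed_transfer (hJ : Measurable (Function.uncurry J)) (hJb : ∀ x y, |J x y| ≤ CJ) (hsymm : ∀ x y, J x y = J y x)
    (hg : Measurable g) (hgb : ∀ x, |g x| ≤ Cg) (hgS : ∀ x, x ∉ S → g x = 0) (hST : S ⊆ T) (hT : MeasurableSet T)
    (hD : Measurable D) (hDb : ∀ x, |D x| ≤ CD) (hD0 : ∀ x, 0 ≤ D x) (hZS : 0 < ∫ x in S, D x ∂μ)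
    (hglob : (∫ x, g x ^ 2 * D x ∂μ) - (∫ x, g x * D x ∂μ) ^ 2 / (∫ x, D x ∂μ) ≤ P₀ * ((1 / 2) * ∫ x, ∫ y, (g x - g y) ^ 2 * J x y ∂μ ∂μ)) :
    (∫ x in S, g x ^ 2 * D x ∂μ) - (∫ x in S, g x * D x ∂μ) ^ 2 / (∫ x in S, D x ∂μ) ≤
      P₀ * ((1 / 2) * (∫ x in T, ∫ y in T, (g x - g y) ^ 2 * J x y ∂μ ∂μ) + ∫ x in S, g x ^ 2 * (∫ y in Tᶜ, J x y ∂μ) ∂μ) := by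
  have hgT : ∀ x, x ∉ T → g x = 0 := fun x hx => hgS x fun h => hx (hST h)
  have ek : ∫ x in T, g x ^ 2 * (∫ y in Tᶜ, J x y ∂μ) ∂μ = ∫ x in S, g x ^ 2 * (∫ y in Tᶜ, J x y ∂μ) ∂μ := by
    rw [setIntegral_eq_integral_of_forall_compl_eq_zero fun x hx => by simp [hgT x hx],
      setIntegral_eq_integral_of_forall_compl_eq_zero fun x hx => by simp [hgS x hx]]
  calc _ ≤ (∫ x, g x ^ 2 * D x ∂μ) - (∫ x, g x * D x ∂μ) ^ 2 / (∫ x, D x ∂μ) := setVariance_le_variance hD hDb hD0 hgS hZS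
    _ ≤ _ := hglob
    _ = _ := by rw [jumpForm_eq_censored_add_killing hJ hJb hsymm hg hgb hgT hT, ek]

/-- ★★ **"DOOR v2" SHAPE: the door's (P) plus an `L²(D)` killing slack.**  In the setting of `killed_transfer`, with the censored kernel `J₀`
(`= J` on `T × T`, `0` off it) and an EXIT-MASS bound `∫_{Tᶜ} J(x,y) dy ≤ ε·D(x)` for `x ∈ S` (the fraction of flat jump mass leaving `T` from the
support of `g`): `∫_S g²D − (∫_S gD)²/∫_S D ≤ P₀·½∫∫(g(x)−g(y))²J₀ + P₀·ε·∫_S g²D`.  The slack is a MASS term, not a form term: it cannot be absorbed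
into `P₀` (see `path_censored_fails`), it has to be carried through the door. [folklore] -/
theorem killed_transfer_door (hJ : Measurable (Function.uncurry J)) (hJb : ∀ x y, |J x y| ≤ CJ) (hsymm : ∀ x y, J x y = J y x)
    (hg : Measurable g) (hgb : ∀ x, |g x| ≤ Cg) (hgS : ∀ x, x ∉ S → g x = 0) (hS : MeasurableSet S) (hST : S ⊆ T) (hT : MeasurableSet T)
    (hD : Measurable D) (hDb : ∀ x, |D x| ≤ CD) (hD0 : ∀ x, 0 ≤ D x) (hZS : 0 < ∫ x in S, D x ∂μ) (hP₀ : 0 ≤ P₀)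
    (hin : ∀ x ∈ T, ∀ y ∈ T, J₀ x y = J x y) (hout : ∀ x y, x ∉ T ∨ y ∉ T → J₀ x y = 0)
    (hκ : ∀ x ∈ S, ∫ y in Tᶜ, J x y ∂μ ≤ ε * D x)
    (hglob : (∫ x, g x ^ 2 * D x ∂μ) - (∫ x, g x * D x ∂μ) ^ 2 / (∫ x, D x ∂μ) ≤ P₀ * ((1 / 2) * ∫ x, ∫ y, (g x - g y) ^ 2 * J x y ∂μ ∂μ)) :
    (∫ x in S, g x ^ 2 * D x ∂μ) - (∫ x in S, g x * D x ∂μ) ^ 2 / (∫ x in S, D x ∂μ) ≤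
      P₀ * ((1 / 2) * ∫ x, ∫ y, (g x - g y) ^ 2 * J₀ x y ∂μ ∂μ) + P₀ * ε * ∫ x in S, g x ^ 2 * D x ∂μ := by
  have h := killed_transfer (μ := μ) hJ hJb hsymm hg hgb hgS hST hT hD hDb hD0 hZS hglob
  rw [← censoredForm_eq (μ := μ) (g := g) hin hout hT] at h
  obtain ⟨hκm, hκb⟩ := killingDensity_bdd (μ := μ) hJ hJb T
  have i1 : Integrable (fun x => g x ^ 2 * ∫ y in Tᶜ, J x y ∂μ) (μ.restrict S) :=
    integrable_of_measurable_abs_le (μ.restrict S) ((hg.pow_const 2).mul hκm) (C := Cg ^ 2 * (CJ * (μ.restrict Tᶜ).real Set.univ)) fun x => by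
      rw [abs_mul, abs_pow]
      exact mul_le_mul (pow_le_pow_left₀ (abs_nonneg _) (hgb x) 2) (hκb x) (abs_nonneg _) (sq_nonneg _)
  have i2 : Integrable (fun x => g x ^ 2 * (ε * D x)) (μ.restrict S) :=
    integrable_of_measurable_abs_le (μ.restrict S) ((hg.pow_const 2).mul (hD.const_mul ε)) (C := Cg ^ 2 * (|ε| * CD)) fun x => by
      rw [abs_mul, abs_pow, abs_mul]
      exact mul_le_mul (pow_le_pow_left₀ (abs_nonneg _) (hgb x) 2) (mul_le_mul_of_nonneg_left (hDb x) (abs_nonneg _))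
        (mul_nonneg (abs_nonneg _) (abs_nonneg _)) (sq_nonneg _)
  have hk : ∫ x in S, g x ^ 2 * (∫ y in Tᶜ, J x y ∂μ) ∂μ ≤ ∫ x in S, g x ^ 2 * (ε * D x) ∂μ :=
    setIntegral_mono_on i1 i2 hS fun x hx => mul_le_mul_of_nonneg_left (hκ x hx) (sq_nonneg _)
  have e : ∫ x in S, g x ^ 2 * (ε * D x) ∂μ = ε * ∫ x in S, g x ^ 2 * D x ∂μ := by
    rw [← integral_const_mul]
    exact integral_congr_ae (ae_of_all _ fun x => by ring)
  rw [e] at hk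
  have hk' := mul_le_mul_of_nonneg_left hk hP₀
  linarith

/-- ★★ **THE MASS SLACK IN MEAN FORM (renormalised constant), valid iff `P₀ε < 1`.**  Since `∫_S g²D = Var_S^D(g) + (∫_S gD)²/∫_S D` identically, the conclusion of
`killed_transfer_door` is, for `P₀ε < 1`, EQUIVALENT to the door-v2 shape with a MEAN-type slack and the renormalised constant `P₀/(1−P₀ε)`:
`∫_S g²D − (∫_S gD)²/∫_S D ≤ (P₀/(1−P₀ε))·½∫∫(g(x)−g(y))²J₀ + (P₀ε/(1−P₀ε))·(∫_S gD)²/∫_S D`.  At `P₀ε = 1` the conversion is void — the three-point witness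
(`path_meanSlack_fails`: `P₀ = ε = 1`) sits exactly there; in a regime `ε → 0` (e.g. `ε ∼ e^{−cℓ²}`) the price is the factor `1/(1−P₀ε) → 1` on the constant plus a vanishing mean slack.
[folklore] -/
theorem killed_transfer_meanForm (hJ : Measurable (Function.uncurry J)) (hJb : ∀ x y, |J x y| ≤ CJ) (hsymm : ∀ x y, J x y = J y x)
    (hg : Measurable g) (hgb : ∀ x, |g x| ≤ Cg) (hgS : ∀ x, x ∉ S → g x = 0) (hS : MeasurableSet S) (hST : S ⊆ T) (hT : MeasurableSet T)
    (hD : Measurable D) (hDb : ∀ x, |D x| ≤ CD) (hD0 : ∀ x, 0 ≤ D x) (hZS : 0 < ∫ x in S, D x ∂μ) (hP₀ : 0 ≤ P₀)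
    (hin : ∀ x ∈ T, ∀ y ∈ T, J₀ x y = J x y) (hout : ∀ x y, x ∉ T ∨ y ∉ T → J₀ x y = 0)
    (hκ : ∀ x ∈ S, ∫ y in Tᶜ, J x y ∂μ ≤ ε * D x) (hε1 : P₀ * ε < 1)
    (hglob : (∫ x, g x ^ 2 * D x ∂μ) - (∫ x, g x * D x ∂μ) ^ 2 / (∫ x, D x ∂μ) ≤ P₀ * ((1 / 2) * ∫ x, ∫ y, (g x - g y) ^ 2 * J x y ∂μ ∂μ)) :
    (∫ x in S, g x ^ 2 * D x ∂μ) - (∫ x in S, g x * D x ∂μ) ^ 2 / (∫ x in S, D x ∂μ) ≤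
      (P₀ / (1 - P₀ * ε)) * ((1 / 2) * ∫ x, ∫ y, (g x - g y) ^ 2 * J₀ x y ∂μ ∂μ) +
        (P₀ * ε / (1 - P₀ * ε)) * ((∫ x in S, g x * D x ∂μ) ^ 2 / (∫ x in S, D x ∂μ)) := by
  have h := killed_transfer_door (μ := μ) hJ hJb hsymm hg hgb hgS hS hST hT hD hDb hD0 hZS hP₀ hin hout hκ hglob
  have h1 : 0 < 1 - P₀ * ε := sub_pos.2 hε1
  set A : ℝ := ∫ x in S, g x ^ 2 * D x ∂μ
  set q : ℝ := (∫ x in S, g x * D x ∂μ) ^ 2 / (∫ x in S, D x ∂μ)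
  set E : ℝ := (1 / 2) * ∫ x, ∫ y, (g x - g y) ^ 2 * J₀ x y ∂μ ∂μ
  have e1 : (A - q) * (1 - P₀ * ε) = (A - q - P₀ * ε * A) + P₀ * ε * q := by ring
  have key : (A - q) * (1 - P₀ * ε) ≤ P₀ * E + P₀ * ε * q := by rw [e1]; linarith
  calc A - q = ((A - q) * (1 - P₀ * ε)) / (1 - P₀ * ε) := by field_simp
    _ ≤ (P₀ * E + P₀ * ε * q) / (1 - P₀ * ε) := div_le_div_of_nonneg_right key h1.le
    _ = P₀ / (1 - P₀ * ε) * E + P₀ * ε / (1 - P₀ * ε) * q := by ring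

end General

/-! ## §3 ★★ The three-point witness: the censored inequality is NOT inherited, and the killing slack is sharp -/

section Witness

variable {D g : Fin 3 → ℝ} {J : Fin 3 → Fin 3 → ℝ} {S : Set (Fin 3)}

/-- Set integrals over the two end points `{0, 2}` of the path are two-term sums (counting measure). [folklore] -/
theorem setIntegral_ends (f : Fin 3 → ℝ) : ∫ x in ({0, 2} : Set (Fin 3)), f x ∂Measure.count = f 0 + f 2 := by
  rw [← Finset.coe_pair, setIntegral_finset _ Integrable.of_finite]
  simp

/-- … and over their complement, the mid point `{1}`. [folklore] -/
theorem setIntegral_ends_compl (f : Fin 3 → ℝ) : ∫ x in ({0, 2} : Set (Fin 3))ᶜ, f x ∂Measure.count = f 1 := by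
  have hc : ({0, 2} : Set (Fin 3))ᶜ = ((({1} : Finset (Fin 3))) : Set (Fin 3)) := by
    ext x; fin_cases x <;> simp
  rw [hc, setIntegral_finset _ Integrable.of_finite]
  simp

/-- ★ **Global Poincaré for the path `0 — 1 — 2` with the sharp constant `P₀ = 1`** (counting measure, flat weight `D ≡ 1`, jump kernel `J` = adjacency):
`Σ g² − (Σ g)²/3 ≤ ½ΣΣ (g(x)−g(y))²J(x,y)`, i.e. `(a−c)² ≤ 2(a−b)² + 2(b−c)²` (`1` = the spectral gap of the path). [folklore] -/
theorem path_poincare (hD : D = fun _ => 1) (hJ : J = ![![0, 1, 0], ![1, 0, 1], ![0, 1, 0]]) (g : Fin 3 → ℝ) :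
    (∫ x, g x ^ 2 * D x ∂Measure.count) - (∫ x, g x * D x ∂Measure.count) ^ 2 / (∫ x, D x ∂Measure.count) ≤
      1 * ((1 / 2) * ∫ x, ∫ y, (g x - g y) ^ 2 * J x y ∂Measure.count ∂Measure.count) := by
  subst hD hJ
  simp [integral_count, Fin.sum_univ_three]
  nlinarith [sq_nonneg (g 0 - 2 * g 1 + g 2)]

/-- ★★ **The censored inequality fails with EVERY constant.**  Same path; `S = {0, 2}` (the end points), `g = (1, 0, −1)` (supported in `S`), and the
jump kernel CENSORED to `S × S` (the indicator kernel `𝟙_{S×S}·J` — identically `0`: the end points are not adjacent).  Then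
`∫_S g²D − (∫_S gD)²/∫_S D = 2` while the censored form vanishes, so the door's (P) `… ≤ P·½∫∫(g(x)−g(y))²J₀` FAILS for every `P : ℝ`, although the
GLOBAL inequality holds with `P₀ = 1` (`path_poincare`). [folklore] -/
theorem path_censored_fails (hD : D = fun _ => 1) (hJ : J = ![![0, 1, 0], ![1, 0, 1], ![0, 1, 0]]) (hS : S = {0, 2}) (hg : g = ![1, 0, -1]) (P : ℝ) :
    ¬ ((∫ x in S, g x ^ 2 * D x ∂Measure.count) - (∫ x in S, g x * D x ∂Measure.count) ^ 2 / (∫ x in S, D x ∂Measure.count) ≤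
        P * ((1 / 2) * ∫ x, ∫ y, (g x - g y) ^ 2 * (S ×ˢ S).indicator (Function.uncurry J) (x, y) ∂Measure.count ∂Measure.count)) := by
  subst hD hJ hS hg
  rw [setIntegral_ends, setIntegral_ends, setIntegral_ends]
  simp [integral_count, Fin.sum_univ_three, Set.indicator_apply]

/-- ★★ **The killing slack carries the whole variance (tightness of `killed_transfer`).**  Same data, `T = S = {0, 2}`: the censored form
`∫_S∫_S (g(x)−g(y))²J` is `0`, the killing form `∫_S g(x)²·(∫_{Sᶜ} J(x,y) dy) dx = 1·J(0,1) + 1·J(2,1)` is `2`, and `∫_S g²D − (∫_S gD)²/∫_S D = 2 = P₀·(½·0 + 2)`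
with the sharp global constant `P₀ = 1`: the conclusion of `killed_transfer` holds with EQUALITY here, so its slack term can be neither dropped nor
given a smaller constant at this generality. [folklore] -/
theorem path_killed_eq (hD : D = fun _ => 1) (hJ : J = ![![0, 1, 0], ![1, 0, 1], ![0, 1, 0]]) (hS : S = {0, 2}) (hg : g = ![1, 0, -1]) :
    (∫ x in S, ∫ y in S, (g x - g y) ^ 2 * J x y ∂Measure.count ∂Measure.count) = 0 ∧
    (∫ x in S, g x ^ 2 * (∫ y in Sᶜ, J x y ∂Measure.count) ∂Measure.count) = 2 ∧
    (∫ x in S, g x ^ 2 * D x ∂Measure.count) - (∫ x in S, g x * D x ∂Measure.count) ^ 2 / (∫ x in S, D x ∂Measure.count) = 2 ∧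
    (∫ x in S, g x ^ 2 * D x ∂Measure.count) - (∫ x in S, g x * D x ∂Measure.count) ^ 2 / (∫ x in S, D x ∂Measure.count) =
      1 * ((1 / 2) * (∫ x in S, ∫ y in S, (g x - g y) ^ 2 * J x y ∂Measure.count ∂Measure.count) +
        ∫ x in S, g x ^ 2 * (∫ y in Sᶜ, J x y ∂Measure.count) ∂Measure.count) := by
  subst hD hJ hS hg
  simp_rw [setIntegral_ends_compl]
  rw [setIntegral_ends, setIntegral_ends, setIntegral_ends, setIntegral_ends, setIntegral_ends, setIntegral_ends, setIntegral_ends]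
  simp
  norm_num

/-- ★★ **Nor is a MEAN-type slack inherited.**  Same data: the witness `g = (1, 0, −1)` has flat mean `∫_S gD = 0`, so for EVERY `P` and EVERY `δ` the variant
`∫_S g²D − (∫_S gD)²/∫_S D ≤ P·½∫∫(g(x)−g(y))²J₀ + δ·(∫_S gD)²/∫_S D` (censored kernel `J₀ = 𝟙_{S×S}J`, slack on the MEAN term) FAILS (`2 ≤ 0`), although the global
inequality holds with `P₀ = 1`: the killing slack inherited from a global Poincaré inequality is the MASS term `P₀ε∫_S g²D` of `killed_transfer_door`, not a mean term. [folklore] -/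
theorem path_meanSlack_fails (hD : D = fun _ => 1) (hJ : J = ![![0, 1, 0], ![1, 0, 1], ![0, 1, 0]]) (hS : S = {0, 2}) (hg : g = ![1, 0, -1]) (P δ : ℝ) :
    ¬ ((∫ x in S, g x ^ 2 * D x ∂Measure.count) - (∫ x in S, g x * D x ∂Measure.count) ^ 2 / (∫ x in S, D x ∂Measure.count) ≤
        P * ((1 / 2) * ∫ x, ∫ y, (g x - g y) ^ 2 * (S ×ˢ S).indicator (Function.uncurry J) (x, y) ∂Measure.count ∂Measure.count) +
          δ * ((∫ x in S, g x * D x ∂Measure.count) ^ 2 / (∫ x in S, D x ∂Measure.count))) := by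
  subst hD hJ hS hg
  rw [setIntegral_ends, setIntegral_ends, setIntegral_ends]
  simp [integral_count, Fin.sum_univ_three, Set.indicator_apply]

/-- ★★ **THE CENSORED POINCARÉ INEQUALITY IS NOT INHERITED FROM THE GLOBAL ONE.**  There are a finite measure space, a strictly positive flat weight
`D`, a non-negative symmetric jump kernel `J` and a measurable set `S` of positive `D`-mass such that the GLOBAL Poincaré inequality holds for every
test function with constant `1`, yet for every constant `P` some `g` supported in `S` violates the door's (P) for the kernel censored to `S × S`.
Hence (P) of `StiffDoor.form_le_of_quasimode_of_comparison` is an independent input: it must come from a censored Poincaré inequality on `{Θ > 0}` or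
from `killed_transfer` with its killing slack carried through the door (`killed_transfer_door`). [folklore] -/
theorem censored_poincare_not_inherited :
    ∃ (D : Fin 3 → ℝ) (J : Fin 3 → Fin 3 → ℝ) (S : Set (Fin 3)),
      (∀ x, 0 < D x) ∧ (∀ x y, 0 ≤ J x y) ∧ (∀ x y, J x y = J y x) ∧ MeasurableSet S ∧ 0 < ∫ x in S, D x ∂Measure.count ∧
      (∀ g : Fin 3 → ℝ, (∫ x, g x ^ 2 * D x ∂Measure.count) - (∫ x, g x * D x ∂Measure.count) ^ 2 / (∫ x, D x ∂Measure.count) ≤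
        1 * ((1 / 2) * ∫ x, ∫ y, (g x - g y) ^ 2 * J x y ∂Measure.count ∂Measure.count)) ∧
      ∀ P : ℝ, ∃ g : Fin 3 → ℝ, (∀ x, x ∉ S → g x = 0) ∧
        ¬ ((∫ x in S, g x ^ 2 * D x ∂Measure.count) - (∫ x in S, g x * D x ∂Measure.count) ^ 2 / (∫ x in S, D x ∂Measure.count) ≤
            P * ((1 / 2) * ∫ x, ∫ y, (g x - g y) ^ 2 * (S ×ˢ S).indicator (Function.uncurry J) (x, y) ∂Measure.count ∂Measure.count)) := by
  refine ⟨fun _ => 1, ![![0, 1, 0], ![1, 0, 1], ![0, 1, 0]], {0, 2}, fun _ => one_pos, fun x y => ?_, fun x y => ?_, (Set.toFinite _).measurableSet, ?_,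
    fun g => path_poincare rfl rfl g, fun P => ⟨![1, 0, -1], fun x hx => ?_, path_censored_fails rfl rfl rfl rfl P⟩⟩
  · fin_cases x <;> fin_cases y <;> simp
  · fin_cases x <;> fin_cases y <;> simp
  · rw [setIntegral_ends]; norm_num
  · fin_cases x <;> simp_all

end Witness

end Summit.QuantumFields.YangMills.Theorems.TwistedTraceScaling.Negative.R63

end
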